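import Summits.Ventures.QEC.Census.CertCoverBatch
import Summits.Ventures.QEC.Census.TwoBGA.TB_l6m24_A0_0_0_1_3_11_B0_0_1_11_5_4.CoreDefs
import HarnessLib

set_option Elab.async false
set_option maxRecDepth 200000

/-!
# `[[288,12,16]]` one-level cover certificate of `TB_l6m24_A0_0_0_1_3_11_B0_0_1_11_5_4` — LEVEL-1→0 coset problems 67…80 (deep problems [5] excluded: `ProbDeep*.lean`) as COMPACT data
(`ProbData`: U, f, σ, y₀, allow; qec-type-10 `CertCoverBatch.mkCoset` rebuilds each `CosetProb` in the kernel) + their verdict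
`probsOK cov covR hx hx1 D1 lxd 14` (one `decide +kernel`; 14 problems, depths f=0:5 f=1:9 f=2:0 f=3:0, est. 89.5 s).
qec-search-1 g5 (pattern of search-9 g5 `Probs*`); data from JSON `level10.problems` (sha256 fee0559d1bce5e88…). Data + decided check; KERNEL.
-/

namespace Summit.Ventures.QEC.Census.TB_l6m24_A0_0_0_1_3_11_B0_0_1_11_5_4

open Matrix Summit.Ventures.QEC.Census Literature.InformationTheory.QuantumCodes

/-- Problems 67…80 (14): `⟨U, f, σ, y₀, allow⟩`. -/
def probs06a : List ProbData := [
    ⟨1412304804943501990171164350095589505, 1, 442726378960842653696, 83076749736557537204393120620347392, [0]⟩,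
    ⟨1443458586094106493033670309289427073, 0, 442726378964063912064, 114230530887766502976706396549021696, [0]⟩,
    ⟨1453843179813291473330542628248223745, 1, 12885033472, 1453843179810873621691313361308876801, [0]⟩,
    ⟨1495381534970639068448107246452281602, 0, 9605750200483842, 1329228035400810518765960755062833410, [0]⟩,
    ⟨1495381554680966221740268442596999425, 1, 885452757921685307392, 166153499473115074408786241240694784, [0]⟩,
    ⟨1526535335831570724602774401790836993, 0, 885452757924906565760, 197307280624324040181099517169369088, [0]⟩,
    ⟨1578458304420545188059024998902267905, 1, 25770066944, 1329228055210873461880518791472873473, [0]⟩,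
    ⟨1661535054155894684878476627599819265, 1, 1770905515843370614784, 332306998946230148817572482481389568, [0]⟩,
    ⟨1827688553635052617515989740210356225, 1, 51540133888, 9671406556917067757387776, [0]⟩,
    ⟨1828337590732702789084964897713815552, 0, 2305843198193827840, 649037107316855759409355615633408, [0]⟩,
    ⟨1993842053105751611154892997605458945, 1, 3541811031686741229568, 664613997892460297635144964962779136, [0]⟩,
    ⟨1994166571652163566585770345836314625, 1, 72198331559837698, 1329552573759696185328843482334232577, [0]⟩,
    ⟨2326149052044729385682567956973748225, 1, 0, 0, [0]⟩,
    ⟨2326798089161712925632411441982078976, 0, 2305843146653698048, 2326149052044724663316085087328534528, [0]⟩]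

set_option maxHeartbeats 400000000 in
/-- Every problem of this chunk passes (`mkCoset` elimination + `cosetOKD` + fast `σ` + depth + `BU`-evenness + label checks). -/
theorem probs06a_ok : probsOK TB_l6m24_A0_0_0_1_3_11_B0_0_1_11_5_4.cov covR hx hx1 D1 lxd 14 probs06a = true := by
  decide +kernel

/-- Pointwise form. -/
theorem probs06a_all : ∀ x ∈ probs06a, probOK TB_l6m24_A0_0_0_1_3_11_B0_0_1_11_5_4.cov covR hx hx1 D1 lxd 14 x = true := by
  have h := probs06a_ok
  rwa [probsOK, List.all_eq_true] at h

end Summit.Ventures.QEC.Census.TB_l6m24_A0_0_0_1_3_11_B0_0_1_11_5_4
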